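/-
Copyright (c) 2026 the pub-hodgecm-mathlib formalisation cell (harness21).  Prover seat hodgecm-mathlib-A-p12 (g22), 2026-09-01.  Road «S3-tree» (architect A-p16 (g30)
A-94 (2) ∕ A-97 «P-1 ASSEMBLY»), brick T3′ «depth-zero κ-transfer», THE TYPE-(1) ASSEMBLY (part 3∕3: the clause) — over the ★ organs of F0P3b-p01 (g11) (socket, unit row), A-p12 (g21)
(ROW-0), A-p19 (g25) (ROW-2), F0P3a-p03 (g15) (O8c H-values).
-/
import Literature.NumberTheory.Rogawski1990.DepthZeroKappaTransferTypeOneGSide               -- part 2∕3 (this seat): the G-side `finsum_finExplicitDelta_mul_classOrbitalIntegral_depthZero_eq_of_split`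
import Literature.NumberTheory.Rogawski1990.UnitFundamentalLemmaExplicitNonsplitClosedProof   -- ★ the template `isLocalUnitTransfer_of_nonsplit_of_isUnit_two` and its imports (scalars, eigenframe, exponents)
import Literature.NumberTheory.Rogawski1990.DepthZeroTransferHValuesTypeOne                   -- ★ p846285 O8c `stableOrbitalIntegralRel_chiZero∕chiOne_eq_…` (F0P3a-p03 (g15))
import Literature.NumberTheory.Rogawski1990.UnitaryVertexStabilizerSpanCM                     -- ★ `setOf_residuallyUnipotent_endoEmbLocal_mem_nhds_one` (A-p16 (g29))
import Literature.NumberTheory.Rogawski1990.FinExplicitTransferFactorResiduallyRegular         -- ★ `charpoly_map_endoEmbLocal_apply`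
import HarnessLib

/-!
# T3′ (P-1): the depth-zero κ-transfer at the hyperspecial vertex, TYPE ONE — part 3∕3: the assembly

Topic `NumberTheory/Rogawski1990`; namespace `Literature.NumberTheory.Rogawski1990`.  THEOREMS ONLY (no definition, no instance, no notation, no named fact, no `sorry`);
kernel lane `--supports stmt-HodgeConjecture-24833`.  Cell `pub/hodgecm-mathlib`, crux H413; road «S3-tree», brick T3′ «depth-zero κ-transfer» (DESIGN v2 §2 (P-1), HEAD v4
8caecb47), END waypoint `localTransferAtOne_of_hyperspecialLevel_le_one` (F0P3a-p03 (g15) fold v1-le1 82802cfb: `stub_T3prime_typeOne := depthZeroKappaTransfer_hyperspecial_typeOne`).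
HONEST LABEL: HC_CM is proved only modulo the cell's 2 remaining named inputs (hLiu418 24832, h413 24833) until rung 0 closes; this file asserts nothing printed — it is an
assembly of ★ organs.

THE STATEMENT (`depthZeroKappaTransfer_hyperspecial_typeOne`, binders = HEAD v4 clause (P-1) VERBATIM).  At an unramified non-split place `v ∤ 2` of good reduction, for a
depth-zero piece `g ∈ C_c^∞(G′_v)` at the hyperspecial vertex (supported in `K = U(H′)(𝒪_v)`, `Ad K`-invariant, constant `= c r` on the residually-unipotent Jordan strata
`r = rank(k̄_w − 1)` of `K`), arbitrary Haar measures `ν_H, ν_G` and the canonical orbital-measure families: there is `V ∈ 𝓝 (1 : H_v)` such that for every `G`-regular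
`γ_H ∈ V` of TYPE ONE (`χ_g` has a root in `L_w`; `γ_H` not `H_v`-conjugate to a diagonal element)
  `Σᶠ_c Δ‴_v(γ_H, c)·Φ(c, g) = a₀·Φ^st(γ_H, χ₀) + a₁·Φ^st(γ_H, χ₁)`,
`a₀ = (ν_G(K)∕ν_H(K_H))·(q⁻² c₀ + ((q²−1)∕q²) c₁)`, `a₁ = (ν_G(K)∕ν_H(K_H))·(−q⁻¹ c₁ + ((q+1)∕q) c₂)`, `χ₀ = 1_{K_H}·[h̄_W = 1]`, `χ₁ = 1_{K_H}·[h̄_W unipotent of rank 1]`.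

THE PROOF (template: the (P3)-split branch of ★ `isLocalUnitTransfer_of_nonsplit_of_isUnit_two`).  `V :=` the residually-unipotent locus of `ι_v` (★
`setOf_residuallyUnipotent_endoEmbLocal_mem_nhds_one`) ⇒ integral characteristic polynomial (★ `v_charpoly_coeff_le_one_of_residuallyUnipotent`) and DEEP eigenvalues
`α, γ, u_w ≡ 1 (mod 𝔪_w)` (part 1∕3 §1, ★ `charpoly_map_endoEmbLocal_apply`); exponents ★ `exists_flicker_exponents_split` (`N₁ = ord(α−u)`, `N₂ = ord(γ−u)`, `N = ord(α−γ)`, all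
`≥ 1` by deepness, ultrametric trichotomy); Flicker's scalars ★ `exists_flicker_scalars_of_nonsplit`, eigenframe ★ `exists_eigenframe_cmDatum_local_of_isRoot_map_of_separable`
with norm-one eigenvalues ★ `forall_conjLocal_mul_eq_one_of_not_exists_conj_glDiagonal` (non-Levi); the G-side is part 2∕3 (`…TypeOneGSide`: representatives ★ `exists_four_matched_flicker_representatives` fix the
strata counts `n i r`; the SOCKET ★ `finsum_finExplicitDelta_mul_classOrbitalIntegral_eq_of_split_of_strata` with `M = ν_G(K)`: its four values are ★
`classOrbitalIntegral_eq_mul_strata_of_congr_flickerTorusElt{,One}`, the counts being literal-invariants through their closed forms (ROW-0 ★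
`ncard_rankStratum_zero_eq_phiOne∕phiZero_of_congr`, ROW-2 ★ `ncard_rankStratum_two_eq_of_congr{,_one}`, the unit row ★ `sum_ncard_rankStrata_eq_phiOne∕phiZero_of_congr`);
its three κ-sums are ★ `Flicker1998.flicker_theorem15` at `(N₁,N₂,N)` and at `(N₁−1,N₂−1,N−1)`, and the parity bookkeeping of the free row, part 1∕3 §2); the H-side is ★ O8c
`stableOrbitalIntegralRel_chiZero_eq_mul_phiH_of_isRoot` ∕ `…chiOne_eq_mul_phiH_sub_of_isRoot` and `ν_H(K_H) ≠ 0`.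

## References
* [Rogawski1990] J. D. Rogawski, *Automorphic Representations of Unitary Groups in Three Variables*, Ann. of Math. Stud. 123 (1990): §4.9 Prop. 4.9.1 (a)(b) pp. 54–55,
  Lemma 4.9.3 p. 56; §4.3 (4.3.1)–(4.3.2) p. 43; §8.1 Prop. 8.1.1 p. 112.
* [Flicker1998UnitaryFL] Y. Z. Flicker, *Elementary proof of the fundamental lemma for a unitary group*, Canad. J. Math. 50 (1998): Prop. 3 p. 78, Props. 11–14 pp. 87–94,
  §6 Thm. 15 p. 95.
* [LanglandsShelstad1987] R. P. Langlands, D. Shelstad, *On the definition of transfer factors*, Math. Ann. 278 (1987): §1.3–1.4.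
* [Kottwitz1986] R. Kottwitz, *Base change for unit elements of Hecke algebras*, Compositio Math. 60 (1986): §3.
-/

set_option autoImplicit false

noncomputable section

open MeasureTheory Measure Set Function NumberField IsDedekindDomain Matrix Polynomial Topology Filter
open Literature.NumberTheory.Automorphic Literature.NumberTheory.Automorphic.UnitaryGroup
open Literature.NumberTheory.Automorphic.IntegralReduction Literature.NumberTheory.GaloisRepresentations
open scoped Matrix MatrixGroups ValuativeRel

namespace Literature.NumberTheory.Rogawski1990

/-! ## The assembly -/

set_option maxHeartbeats 800000 in
open scoped Classical in
/-- **T3′ HEAD v4, CLAUSE (P-1) TYPE ONE — PROVED** (see the module docstring; binders VERBATIM = END v1-le1 `stub_T3prime_typeOne`).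
[cite: Rogawski1990, §4.9 Prop. 4.9.1 (a) p. 55; §4.3 (4.3.1)–(4.3.2) p. 43; §8.1 Prop. 8.1.1 p. 112] [cite: Flicker1998UnitaryFL, §6 Thm. 15 p. 95] [cite: LanglandsShelstad1987, §1.3–1.4]
[cite: Kottwitz1986, §3] -/
theorem depthZeroKappaTransfer_hyperspecial_typeOne
    (L : Type) [Field L] [NumberField L] [IsCMField L] (H' : Matrix (Fin 3) (Fin 3) L) (μ : HeckeCharacter L)
    {v : HeightOneSpectrum (𝓞 ↥(maximalRealSubfield L))}
    (hH' : (H'.map (cmConjRingHom L)).transpose = H') (w : PlacesOver L v)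
    (hw : IsCMField.complexConj L • w.1 = w.1) (hv : Algebra.IsUnramifiedIn (𝓞 L) v.asIdeal)
    (hH'w : IsUnit (placeForm H' w.1)) (hH'i : hH'w.unit ∈ glInt 3 (w.1.adicCompletion L))
    (hμ : μ.IsUnramifiedAt w.1) (hμu : μ.IsUnitary)
    (hμω : ∀ x : ideleGroup ↥(maximalRealSubfield L), μ (AdeleRing.ideleBaseChange ↥(maximalRealSubfield L) L x) = quadraticHeckeCharCM L x)
    (h2 : IsUnit (2 : 𝒪[w.1.adicCompletion L]))
    [MeasurableSpace ((cmDatum L 3 H').Local v)] [BorelSpace ((cmDatum L 3 H').Local v)]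
    [∀ γ : ((cmDatum L 3 H').Local v), MeasurableSpace (((cmDatum L 3 H').Local v) ⧸ Subgroup.centralizer ({γ} : Set ((cmDatum L 3 H').Local v)))]
    [∀ γ : ((cmDatum L 3 H').Local v), BorelSpace (((cmDatum L 3 H').Local v) ⧸ Subgroup.centralizer ({γ} : Set ((cmDatum L 3 H').Local v)))]
    [MeasurableSpace ((cmDatum L 2 (Matrix.of fun i j : Fin 2 => if i.val + j.val + 1 = 2 then (1 : L) else 0)).Local v ×
      (cmDatum L 1 (Matrix.of fun i j : Fin 1 => if i.val + j.val + 1 = 1 then (1 : L) else 0)).Local v)]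
    [BorelSpace ((cmDatum L 2 (Matrix.of fun i j : Fin 2 => if i.val + j.val + 1 = 2 then (1 : L) else 0)).Local v ×
      (cmDatum L 1 (Matrix.of fun i j : Fin 1 => if i.val + j.val + 1 = 1 then (1 : L) else 0)).Local v)]
    [∀ a : ((cmDatum L 2 (Matrix.of fun i j : Fin 2 => if i.val + j.val + 1 = 2 then (1 : L) else 0)).Local v ×
      (cmDatum L 1 (Matrix.of fun i j : Fin 1 => if i.val + j.val + 1 = 1 then (1 : L) else 0)).Local v),
      MeasurableSpace (((cmDatum L 2 (Matrix.of fun i j : Fin 2 => if i.val + j.val + 1 = 2 then (1 : L) else 0)).Local v ×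
      (cmDatum L 1 (Matrix.of fun i j : Fin 1 => if i.val + j.val + 1 = 1 then (1 : L) else 0)).Local v) ⧸ Subgroup.centralizer ({a} : Set ((cmDatum L 2 (Matrix.of fun i j : Fin 2 => if i.val + j.val + 1 = 2 then (1 : L) else 0)).Local v ×
      (cmDatum L 1 (Matrix.of fun i j : Fin 1 => if i.val + j.val + 1 = 1 then (1 : L) else 0)).Local v)))]
    [∀ a : ((cmDatum L 2 (Matrix.of fun i j : Fin 2 => if i.val + j.val + 1 = 2 then (1 : L) else 0)).Local v ×
      (cmDatum L 1 (Matrix.of fun i j : Fin 1 => if i.val + j.val + 1 = 1 then (1 : L) else 0)).Local v),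
      BorelSpace (((cmDatum L 2 (Matrix.of fun i j : Fin 2 => if i.val + j.val + 1 = 2 then (1 : L) else 0)).Local v ×
      (cmDatum L 1 (Matrix.of fun i j : Fin 1 => if i.val + j.val + 1 = 1 then (1 : L) else 0)).Local v) ⧸ Subgroup.centralizer ({a} : Set ((cmDatum L 2 (Matrix.of fun i j : Fin 2 => if i.val + j.val + 1 = 2 then (1 : L) else 0)).Local v ×
      (cmDatum L 1 (Matrix.of fun i j : Fin 1 => if i.val + j.val + 1 = 1 then (1 : L) else 0)).Local v)))]
    (νH : Measure ((cmDatum L 2 (Matrix.of fun i j : Fin 2 => if i.val + j.val + 1 = 2 then (1 : L) else 0)).Local v ×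
      (cmDatum L 1 (Matrix.of fun i j : Fin 1 => if i.val + j.val + 1 = 1 then (1 : L) else 0)).Local v)) [νH.IsHaarMeasure] [νH.IsMulRightInvariant]
    (νG : Measure ((cmDatum L 3 H').Local v)) [νG.IsHaarMeasure] [νG.IsMulRightInvariant]
    {mH : OrbitalMeasureFamily ((cmDatum L 2 (Matrix.of fun i j : Fin 2 => if i.val + j.val + 1 = 2 then (1 : L) else 0)).Local v ×
      (cmDatum L 1 (Matrix.of fun i j : Fin 1 => if i.val + j.val + 1 = 1 then (1 : L) else 0)).Local v)} {mG : OrbitalMeasureFamily ((cmDatum L 3 H').Local v)}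
    (hmH : mH.IsCanonical (IsLocalGRegular L v) νH)
    (hmG : mG.IsCanonical (fun γ => IsRegularElt (γ.val : GL (Fin 3) (UnitaryGroup.LocalRing L v))) νG)
    -- the depth-zero piece at the hyperspecial vertex: `C_c^∞`, supported in `K`, constant on the residually-unipotent Jordan strata of `K`
    (g : ((cmDatum L 3 H').Local v) → ℂ) (hg : IsLocSmooth g) (hgK : tsupport g ⊆ (cmLocalIntegralLevel L 3 H' v : Set ((cmDatum L 3 H').Local v)))
    (hginv : ∀ u ∈ cmLocalIntegralLevel L 3 H' v, ∀ x, g (u * x * u⁻¹) = g x)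
    (c : ℕ → ℂ)
    (hc : ∀ k ∈ cmLocalIntegralLevel L 3 H' v,
      (redMat (((k.val : GL (Fin 3) (UnitaryGroup.LocalRing L v)).val.map (Pi.evalRingHom (fun w' : PlacesOver L v => w'.1.adicCompletion L) w))) - 1) ^ 3 = 0 →
      g k = c (redMat (((k.val : GL (Fin 3) (UnitaryGroup.LocalRing L v)).val.map (Pi.evalRingHom (fun w' : PlacesOver L v => w'.1.adicCompletion L) w))) - 1).rank) :
    ∃ V ∈ 𝓝 (1 : ((cmDatum L 2 (Matrix.of fun i j : Fin 2 => if i.val + j.val + 1 = 2 then (1 : L) else 0)).Local v ×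
        (cmDatum L 1 (Matrix.of fun i j : Fin 1 => if i.val + j.val + 1 = 1 then (1 : L) else 0)).Local v)),
      ∀ γH ∈ V, IsLocalGRegular L v γH →
        (∃ x : w.1.adicCompletion L, (((γH.1.val : GL (Fin 2) (UnitaryGroup.LocalRing L v)).val.map
          (Pi.evalRingHom (fun w' : PlacesOver L v => w'.1.adicCompletion L) w)).charpoly).IsRoot x) →
        ¬ (∃ (y : ((cmDatum L 2 (Matrix.of fun i j : Fin 2 => if i.val + j.val + 1 = 2 then (1 : L) else 0)).Local v ×
        (cmDatum L 1 (Matrix.of fun i j : Fin 1 => if i.val + j.val + 1 = 1 then (1 : L) else 0)).Local v)) (d' : Fin 2 → (UnitaryGroup.LocalRing L v)ˣ),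
          glDiagonal 2 (UnitaryGroup.LocalRing L v) d' = ((y * γH * y⁻¹).1.val : GL (Fin 2) (UnitaryGroup.LocalRing L v))) →
        ∑ᶠ cG : ConjClasses ((cmDatum L 3 H').Local v),
            ((finExplicitCollection L H' μ (finExplicitDelta_conj_left_all L H' μ) (finExplicitDelta_conj_right_all L H' μ)) v).Δ γH (Quotient.out cG) *
              classOrbitalIntegral mG g cG =
          -- `a₀ · Φ^st(γH, χ₀)`, `a₀ = (ν_G(K)∕ν_H(K_H)) · (q⁻² c 0 + ((q²−1)∕q²) c 1)`, `χ₀ = 1_{{h ∈ K_H : h̄_W = 1}}`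
          ((νG.real (cmLocalIntegralLevel L 3 H' v : Set ((cmDatum L 3 H').Local v)) / νH.real (((cmLocalIntegralLevel L 2 (Matrix.of fun i j : Fin 2 => if i.val + j.val + 1 = 2 then (1 : L) else 0) v).prod
                (cmLocalIntegralLevel L 1 (Matrix.of fun i j : Fin 1 => if i.val + j.val + 1 = 1 then (1 : L) else 0) v) : Subgroup _) : Set _) : ℝ) : ℂ) * (((Ideal.absNorm v.asIdeal : ℂ) ^ 2)⁻¹ * c 0 + (((Ideal.absNorm v.asIdeal : ℂ) ^ 2 - 1) / (Ideal.absNorm v.asIdeal : ℂ) ^ 2) * c 1) *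
              stableOrbitalIntegralRel (IsLocalStablyConjH L v) mH
                ((((cmLocalIntegralLevel L 2 (Matrix.of fun i j : Fin 2 => if i.val + j.val + 1 = 2 then (1 : L) else 0) v).prod
                (cmLocalIntegralLevel L 1 (Matrix.of fun i j : Fin 1 => if i.val + j.val + 1 = 1 then (1 : L) else 0) v) : Subgroup _) : Set _).indicator
              (fun h => if (redMat (((h.1.val : GL (Fin 2) (UnitaryGroup.LocalRing L v)).val.map (Pi.evalRingHom (fun w' : PlacesOver L v => w'.1.adicCompletion L) w))) - 1) ^ 2 = 0 ∧ (redMat (((h.1.val : GL (Fin 2) (UnitaryGroup.LocalRing L v)).val.map (Pi.evalRingHom (fun w' : PlacesOver L v => w'.1.adicCompletion L) w))) - 1).rank = 0 then (1 : ℂ) else 0)) γH +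
          -- `a₁ · Φ^st(γH, χ₁)`, `a₁ = (ν_G(K)∕ν_H(K_H)) · (−q⁻¹ c 1 + ((q+1)∕q) c 2)`, `χ₁ = 1_{{h ∈ K_H : h̄_W unipotent, rank(h̄_W − 1) = 1}}`
          ((νG.real (cmLocalIntegralLevel L 3 H' v : Set ((cmDatum L 3 H').Local v)) / νH.real (((cmLocalIntegralLevel L 2 (Matrix.of fun i j : Fin 2 => if i.val + j.val + 1 = 2 then (1 : L) else 0) v).prod
                (cmLocalIntegralLevel L 1 (Matrix.of fun i j : Fin 1 => if i.val + j.val + 1 = 1 then (1 : L) else 0) v) : Subgroup _) : Set _) : ℝ) : ℂ) * (-((Ideal.absNorm v.asIdeal : ℂ))⁻¹ * c 1 + (((Ideal.absNorm v.asIdeal : ℂ) + 1) / (Ideal.absNorm v.asIdeal : ℂ)) * c 2) *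
              stableOrbitalIntegralRel (IsLocalStablyConjH L v) mH
                ((((cmLocalIntegralLevel L 2 (Matrix.of fun i j : Fin 2 => if i.val + j.val + 1 = 2 then (1 : L) else 0) v).prod
                (cmLocalIntegralLevel L 1 (Matrix.of fun i j : Fin 1 => if i.val + j.val + 1 = 1 then (1 : L) else 0) v) : Subgroup _) : Set _).indicator
              (fun h => if (redMat (((h.1.val : GL (Fin 2) (UnitaryGroup.LocalRing L v)).val.map (Pi.evalRingHom (fun w' : PlacesOver L v => w'.1.adicCompletion L) w))) - 1) ^ 2 = 0 ∧ (redMat (((h.1.val : GL (Fin 2) (UnitaryGroup.LocalRing L v)).val.map (Pi.evalRingHom (fun w' : PlacesOver L v => w'.1.adicCompletion L) w))) - 1).rank = 1 then (1 : ℂ) else 0)) γH := by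
  haveI := Literature.NumberTheory.Automorphic.isAdicComplete_maximalIdeal_valuedInteger_adicCompletion L w.1
  have _hμu := hμu  -- a binder of the clause text (HEAD v4 VERBATIM) not needed by the proof
  have hH'σ : (H'.map (IsCMField.complexConj L))ᵀ = H' := hH'
  have hq : 1 < Ideal.absNorm v.asIdeal :=
    Nat.one_lt_iff_ne_zero_and_ne_one.2 ⟨by rw [Ne, Ideal.absNorm_eq_zero_iff]; exact v.ne_bot,
      by rw [Ne, Ideal.absNorm_eq_one_iff]; exact v.isPrime.ne_top⟩
  have hiso := ValuativeRel.isEquiv (ValuativeRel.valuation (w.1.adicCompletion L))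
    (Valued.v : Valuation (w.1.adicCompletion L) (WithZero (Multiplicative ℤ)))
  -- `H′` is invertible: its image over `L_w` is
  have hH'u : IsUnit H' := by
    rw [Matrix.isUnit_iff_isUnit_det]
    have h := (Matrix.isUnit_iff_isUnit_det _).1 hH'w
    rw [show placeForm H' w.1 = (algebraMap L (w.1.adicCompletion L)).mapMatrix H' from rfl, ← RingHom.map_det] at h
    exact isUnit_iff_ne_zero.2 fun h0 => h.ne_zero (by rw [h0, map_zero])
  -- `2 ∈ 𝒪_w^×` in the other currencies
  have h2w : Valued.v (2 : w.1.adicCompletion L) = 1 := (isUnit_two_integer_iff_valued_eq_one L w.1).1 h2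
  have h2L : (2 : 𝓞 L) ∉ w.1.asIdeal := by
    have e1 : (algebraMap L (w.1.adicCompletion L)) (algebraMap (𝓞 L) L 2) = 2 := by rw [map_ofNat, map_ofNat]
    have h2w' := h2w
    rw [← e1] at h2w'
    change Valued.v ((algebraMap (𝓞 L) L 2 : L) : w.1.adicCompletion L) = 1 at h2w'
    rw [HeightOneSpectrum.valuedAdicCompletion_eq_valuation', HeightOneSpectrum.valuation_of_algebraMap] at h2w'
    exact HeightOneSpectrum.intValuation_eq_one_iff.1 h2w'
  have h2F : (2 : 𝓞 ↥(maximalRealSubfield L)) ∉ v.asIdeal := by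
    intro hmem
    apply h2L
    have h := congrArg HeightOneSpectrum.asIdeal w.2
    rw [← h] at hmem
    simp only [HeightOneSpectrum.under_asIdeal, Ideal.under_def, Ideal.mem_comap, map_ofNat] at hmem
    exact hmem
  have h2v : Valued.v (2 : v.adicCompletion ↥(maximalRealSubfield L)) = 1 := valued_two_adicCompletion_eq_one v h2F
  -- the masses
  have hKHpos : νH.real ((cmLocalIntegralLevel L 2 (Matrix.of fun i j : Fin 2 => if i.val + j.val + 1 = 2 then (1 : L) else 0) v :
        Set ((cmDatum L 2 (Matrix.of fun i j : Fin 2 => if i.val + j.val + 1 = 2 then (1 : L) else 0)).Local v)) ×ˢ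
      (cmLocalIntegralLevel L 1 (Matrix.of fun i j : Fin 1 => if i.val + j.val + 1 = 1 then (1 : L) else 0) v :
        Set ((cmDatum L 1 (Matrix.of fun i j : Fin 1 => if i.val + j.val + 1 = 1 then (1 : L) else 0)).Local v))) ≠ 0 := by
    have hK2 := isCompact_isOpen_cmLocalIntegralLevel L 2 (Matrix.of fun i j : Fin 2 => if i.val + j.val + 1 = 2 then (1 : L) else 0) v
    have hK1 := isCompact_isOpen_cmLocalIntegralLevel L 1 (Matrix.of fun i j : Fin 1 => if i.val + j.val + 1 = 1 then (1 : L) else 0) v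
    rw [measureReal_def]
    exact (ENNReal.toReal_pos ((hK2.2.prod hK1.2).measure_pos νH ⟨(1, 1), Subgroup.one_mem _, Subgroup.one_mem _⟩).ne'
      (hK2.1.prod hK1.1).measure_lt_top.ne).ne'
  -- (0) the neighbourhood: the residually-unipotent locus of `ι_v`
  refine ⟨_, setOf_residuallyUnipotent_endoEmbLocal_mem_nhds_one L v w, ?_⟩
  intro γH hγV hreg hsplit hlev
  simp only [Set.mem_setOf_eq] at hγV
  -- keep the (large) goal out of the eliminators' motives while gathering the data; it comes back at `apply hneg`
  by_contra hneg
  -- integrality of `charpoly(ι_v γ_H)_w` in both currencies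
  have hintV : ∀ i : ℕ, ((((endoEmbLocal L v γH).val : GL (Fin 3) (UnitaryGroup.LocalRing L v)).val.map
      (Pi.evalRingHom (fun w' : PlacesOver L v => w'.1.adicCompletion L) w)).charpoly.coeff i) ∈ Valued.integer (w.1.adicCompletion L) :=
    fun i => (Valuation.mem_integer_iff _ _).2 (v_charpoly_coeff_le_one_of_residuallyUnipotent _ hγV i)
  have hint : ∀ i : ℕ, ((((endoEmbLocal L v γH).val : GL (Fin 3) (LocalRing L v)).val.map
      (Pi.evalRingHom (fun w' : PlacesOver L v => w'.1.adicCompletion L) w)).charpoly.coeff i) ∈ 𝒪[w.1.adicCompletion L] :=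
    fun i => (Valuation.mem_integer_iff _ _).2 ((hiso.le_one_iff_le_one).2 ((Valuation.mem_integer_iff _ _).1 (hintV i)))
  -- (1) the split eigen-data and Flicker's exponents
  obtain ⟨α, γ, N₁, N₂, N, hα, hγ, hαγ, hN₁, hN₂, hN, htri⟩ := exists_flicker_exponents_split L v w hw hreg hintV hsplit
  -- DEEPNESS: the three eigenvalues `α, γ, u_w` of `ι_v(γ_H)_w` are `≡ 1 (mod 𝔪_w)`
  have hfac := charpoly_map_endoEmbLocal_apply L w (γH := γH)
  have hcm : ((((γH.1.val : GL (Fin 2) (LocalRing L v)).val).map (Pi.evalRingHom (fun w' : PlacesOver L v => w'.1.adicCompletion L) w))).charpoly =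
      ((((γH.1.val : GL (Fin 2) (LocalRing L v)) : Matrix (Fin 2) (Fin 2) (LocalRing L v)).charpoly).map
        (Pi.evalRingHom (fun w' : PlacesOver L v => w'.1.adicCompletion L) w)) := Matrix.charpoly_map _ _
  have hα1 : Valued.v (α - 1) < 1 := by
    refine valuation_sub_one_lt_one_of_isRoot_charpoly_of_residuallyUnipotent _ hγV ?_
    rw [hfac, Polynomial.IsRoot, eval_mul, hcm, hα.eq_zero, zero_mul]
  have hγ1 : Valued.v (γ - 1) < 1 := by
    refine valuation_sub_one_lt_one_of_isRoot_charpoly_of_residuallyUnipotent _ hγV ?_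
    rw [hfac, Polynomial.IsRoot, eval_mul, hcm, hγ.eq_zero, zero_mul]
  have hb1 : Valued.v (finGammaTwo L v γH w - 1) < 1 := by
    refine valuation_sub_one_lt_one_of_isRoot_charpoly_of_residuallyUnipotent _ hγV ?_
    rw [hfac, Polynomial.IsRoot, eval_mul, eval_sub, eval_X, eval_C, sub_self, mul_zero]
  -- (2) Flicker's scalars and an eigenframe of `g` with norm-one eigenvalues `u 0 (w) = α`, `u 1 (w) = γ`
  obtain ⟨e, π, x, y, h2e, hσπ, hπu, hπN, hx, hy⟩ := exists_flicker_scalars_of_nonsplit L v w hw hv h2v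
  have hππ : π * (hπu.unit⁻¹ : (LocalRing L v)ˣ) = 1 := hπu.mul_val_inv
  have hsep : (((γH.1.val : GL (Fin 2) (LocalRing L v)) : Matrix (Fin 2) (Fin 2) (LocalRing L v)).charpoly).Separable :=
    (isRegularElt_fst_snd_of_isLocalGRegular L v γH hreg).1
  obtain ⟨P₂, u, hP₂, hu, hu0⟩ := exists_eigenframe_cmDatum_local_of_isRoot_map_of_separable L v w hw γH.1 hα hsep
  have hu1w : u 1 w = γ := by
    rcases eq_or_eq_eval_of_isRoot_of_eigenframe L v w hP₂ hγ with h | h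
    · exact absurd (h.trans hu0) (Ne.symm hαγ)
    · exact h.symm
  have hu1 : ∀ i, conjLocal L (IsCMField.complexConj L) v (u i) * u i = 1 :=
    forall_conjLocal_mul_eq_one_of_not_exists_conj_glDiagonal L v w hw hP₂ hu hlev
  have hP₂' : (γH.1.val.val : Matrix (Fin 2) (Fin 2) (LocalRing L v)) * P₂.val = P₂.val * diagonal ![u 0, u 1] := by
    rw [hP₂]; congr 1; ext i j; fin_cases i <;> fin_cases j <;> rfl
  have hαb : α ≠ finGammaTwo L v γH w := fun h0 => by
    rw [h0, sub_self, map_zero] at hN₁; exact WithZero.zero_ne_coe hN₁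
  have hγb : γ ≠ finGammaTwo L v γH w := fun h0 => by
    rw [h0, sub_self, map_zero] at hN₂; exact WithZero.zero_ne_coe hN₂
  have had : u 0 ≠ u 1 := fun h => zero_ne_one (hu h)
  have hab : u 0 ≠ finGammaTwo L v γH := fun h => hαb (by rw [← hu0, h])
  have hbd : finGammaTwo L v γH ≠ u 1 := fun h => hγb (by rw [← hu1w, ← h])
  -- (3)–(6) the G-side (§4) and the H-side values ★ O8c, then the mass algebra
  apply hneg
  rw [finsum_finExplicitDelta_mul_classOrbitalIntegral_depthZero_eq_of_split L H' hH'σ w hw hv hH'w hH'i μ hμ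
      (finExplicitDelta_conj_left_all L H' μ) (finExplicitDelta_conj_right_all L H' μ) hH'u hμω α γ N₁ N₂ hα hγ hαγ hN₁ hN₂
      h2e hσπ hππ hπN hx hy (hu1 0) (hu1 1) hP₂' had hab hbd hu0 hu1w N hN htri hα1 hγ1 hb1 h2 νG hmG g hg hgK hginv c hc,
    stableOrbitalIntegralRel_chiZero_eq_mul_phiH_of_isRoot L v w hw νH hv hmH hreg hlev α γ hα hγ hαγ N hN hα1 hγ1 _,
    stableOrbitalIntegralRel_chiOne_eq_mul_phiH_sub_of_isRoot L v w hw νH hv hmH hreg hlev α γ hα hγ hαγ N hN hα1 hγ1 _ _]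
  have hKHc := Complex.ofReal_ne_zero.2 hKHpos
  push_cast
  field_simp
  -- what is left: the decidability binders of ★ O8c's `χ₀`, `χ₁` (any instances)
  all_goals exact fun _ => inferInstance

end Literature.NumberTheory.Rogawski1990

end
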